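import Mathlib
import Literature.MathematicalPhysics.QuantumFieldTheory.Balaban1983to89.B1Eq324BenfattoClassMarkov
import Literature.MathematicalPhysics.QuantumFieldTheory.GaussianToolkit
import HarnessLib

/-!
# `Balaban1983to89.B1Eq324BenfattoClassDecoupling` — the substitute for the MARKOV FACTORISATION (5.13) p. 155 of [BenfattoEtAl1978]
# (Commun. Math. Phys. **59** (1978) 143–166) at a Gaussian field whose precision is uniformly elliptic with EXPONENTIALLY DECAYING (not
# finite-range) entries — the situation of [Balaban1985UV3] (58) by [Balaban1985BackgroundPropagators] Sect. E p. 428: TWO-SIDED GAUSSIAN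
# DOMINATION by the field with the BLOCK-DIAGONAL precision along any partition into `w`-separated parts, at temperatures `1 ∓ δ`,
# `δ = M₂e^{−κ′w}/γ` — PROVED (kernel-generic; sequel of `B1Eq324BenfattoClassAppendixC`)

statement-level skeleton of published theorems with citation tags; proofs where landed; nothing here is a claim about the
Yang–Mills mass gap

WHY THIS MODULE (cell `pub-ymgap`, seat `dag-n08-b` gen 7).  The §5 proof of the Basic Lemma of [BenfattoEtAl1978] conditions on the variables in a
system of corridors `Γ` and then uses the MARKOV property of the nearest-neighbour field: «the integral factorizes» over the boxes (5.13) p. 155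
(tree: `B1Eq324BenfattoMarkov.iIndepFun_condField_of_enclosed`, row (M) of the kernel census `HOME/pub-ymgap-dag-n08-c/N08-BASICLEMMA-KERNEL-CENSUS.md`).
At the Gaussian measure of [Balaban1985UV3] (58) this is NOT available: by [Balaban1985BackgroundPropagators] p. 428 (right after (3.156)–(3.158))
the step covariance «is defined by a positive definite operator C*Δ_kC with a lower bound γ₀ > 0 independent of k and U … This property, together with
a uniform exponential decay of C*Δ_kC implies bounds and uniform exponential decay for C^{(k)}(Λ)» — a uniformly elliptic precision with exponentially
decaying, but NOT finite-range, entries (`Δ_k` contains `(QG₁Q*)⁻¹`, (3.156)).  So the conditional covariance across a corridor of width `w` is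
exponentially SMALL (`B1Eq324BenfattoClassAppendixC.abs_schur_le_exp`: `≤ e^{−κw}/(γ − J)`), not zero, and the §5 road needs one new step in place of
(5.13).  This file proves it, in the weakest currency that the LOWER bound (4.7) and the UPPER bound (4.6) both tolerate: two-sided domination of
expectations of NONNEGATIVE functionals, with a volume prefactor `((1+δ)/(1−δ))^{±|Γᶜ|/2}` and a temperature `1 ∓ δ` on the block-diagonal (Dirichlet-box)
precision, `δ = M₂e^{−κ′w}/γ` — at corridor width `w ≍ b^{3/2}` both are of the shape `|I|·S·e^{−ρ₃b^{3/2}}` of the Lemma's error term.  This is OUR reading of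
how §5 survives at B10's data ([Balaban1985UV3] p. 257: «the proof is very sketchy»); it is not in print.

THE PRINTED TEXT being replaced (p. 155, (5.13), as typed in `B1Eq324BenfattoSect5Eq515` / `…PavementStep`): after conditioning on the corridor
variables the box factors are independent, «the integral factorizes»: `∫ Π_□ F_□ dP̄ = Π_□ ∫ F_□ dP̄`.

DICTIONARY.  A finite index set `m` (in the application `m = Γᶜ`, the non-corridor tesserae / bonds), a symmetric PRECISION `B : Matrix m m ℝ`
(`= A|_{Γᶜ}`, whose inverse is the conditional covariance `C^Γ` by `B1Eq324BenfattoClassAppendixC.schur_eq_inv_submatrix_compl`), `γ`-coercive, with the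
weighted row bound `Σ_{y′}|B y y′|e^{κ′·dist y y′} ≤ M₂`; a part map `π : m → σ` («the box containing the site») with parts pairwise at `dist ≥ w`; the
block-diagonal part `B_bd y y′ = [π y = π y′]·B y y′` (inlined as `Matrix.of …`; no definition); Gaussian vectors as Mathlib's `multivariateGaussian 0 P⁻¹`
on `EuclideanSpace ℝ m` in PRECISION form (`GaussianToolkit.multivariateGaussian_inv_eq_withDensity`: density `Z_P⁻¹e^{−½yᵀPy}`).

WHAT IS PROVED (no definition, no named fact, no `sorry`; axioms standard).
* §1 (matrix) `abs_form_cross_le` (Schur: the cross part is form-bounded by the cross row sums `ε`), `form_eq_blockDiag_add_cross`,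
  `coercive_blockDiag` (the block-diagonal part keeps the coercivity constant), ★ `form_blockDiag_two_sided`
  (`(1 − ε/γ)⟨x,B_bd x⟩ ≤ ⟨x,Bx⟩ ≤ (1 + ε/γ)⟨x,B_bd x⟩`), `cross_rowSum_le_exp` (`ε ≤ M₂e^{−κ′w}` across `w`-separated parts).
* §2 (Gaussian, generic) `posDef_smul_of_pos`, `gaussWeight_smul`, ★ `gaussZ_smul` (`Z_{cP} = (√c)^{−|ι|}Z_P`), `lintegral_multivariateGaussian_inv_eq`,
  ★★ `lintegral_multivariateGaussian_le_of_form_le` / ★★ `lintegral_multivariateGaussian_ge_of_form_le`: if `(1−δ)⟨y,P₂y⟩ ≤ ⟨y,P₁y⟩ ≤ (1+δ)⟨y,P₂y⟩`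
  (`0 ≤ δ < 1`) then for every measurable `F ≥ 0`
  `(√((1−δ)/(1+δ)))^{|ι|}∫F dN(0,((1+δ)P₂)⁻¹) ≤ ∫F dN(0,P₁⁻¹) ≤ (√((1+δ)/(1−δ)))^{|ι|}∫F dN(0,((1−δ)P₂)⁻¹)` — pointwise comparison of the
  densities and of the normalisations by scaling; no Hölder, no determinant; `multivariateGaussian_eq_map_add` and the common-MEAN versions
  `lintegral_multivariateGaussian_mean_le_of_form_le` / `_mean_ge_` (the conditional centre rides along).
* §3 ★★ `decoupling` (the three conclusions for a symmetric `γ`-coercive `B` with the weighted row bound and a `w`-separated partition,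
  `δ = M₂e^{−κ′w}/γ < 1`) and ★★ `decoupling_conditional` (the same at `B = A|_{Γᶜ}` for `A` in the class — UNIFORM IN `Γ`: the class constants of
  `A` pass to every principal block by `B1Eq324BenfattoClassAppendixC.coercive_submatrix`); `inv_blockDiag_apply_eq_zero` (the dominating
  measures have block-diagonal covariance: parts uncorrelated, hence independent by the generic Gaussian layer).

* §5 doors from the B9 currency: `coercive_sum_iff_dot` (`QGQInverse.Coercive`'s body ↔ the class `Σ`-form), `rowDefect_cosh_le_of_exp`
  (`(e^{κd} − 1)`-weighted rows ⇒ the `cosh` defect).  PRIOR ART IN THE TREE, recorded: the pub-balaban inversion lemma `QGQInverse.inverse_decay`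
  (B9 (3.132) lineage; coercivity + `(e^{κd} − 1)` row AND column sums, no symmetry) is the same finite Combes–Thomas inversion as
  `B1Eq324BenfattoClassAppendixC.abs_inv_apply_le_exp` (symmetric, `cosh` currency); the doors make either set of hypotheses usable.

HOW IT IS MEANT TO BE USED in a class edition of §5 (not typed here): with `F = Π_□ χ_□e^{Ψ_□}` (nonnegative), the upper bound (4.6) runs through
`∫F dN(m, C^Γ) ≤ (…)^{|Γᶜ|} ∫F dN(m, ((1−δ)B_bd)⁻¹)` (centre `m` = the regression, unchanged: apply the theorem to `F(· + m)`), and under the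
block-diagonal precision the box blocks ARE independent (generic Gaussian; measure layer of seat dag-n08-d's `…Kernel*` editions), each box carrying the
Dirichlet box precision `(1−δ)A|_□` — again in the class, with constants `(1−δ)γ`, `(1−δ)J`; the lower bound (4.7) symmetrically with `1+δ`.

VOLUME FACTOR (a limitation, recorded): the prefactor is `(√((1+δ)/(1−δ)))^{±|m|}`, extensive in the WHOLE index set `m = Γᶜ`, because the
comparison is a scalar multiple of the block-diagonal form; this is adequate where the error budget is itself extensive in the total volume — the
situation of [Balaban1985UV3] (58), whose error is `O((Lᵏε)³⁺ᵏ⁰)|T₁^{(k)}|` — provided `e^{−κ′w}` beats the per-site budget.  An `|I|`-extensive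
refinement (faithful to [BenfattoEtAl1978]'s infinite lattice, where only the boxes near `I` carry a Hamiltonian) would compare `B` with `B_bd ± R`,
`R = diag(cross row sums)`, and needs `log det(1 + X) ≤ tr X`; NOT typed here.

HONEST SCOPE.  Kernel-generic matrix analysis and Gaussian measure comparison; nothing of [Balaban1985UV3] / [Balaban1985BackgroundPropagators] is
asserted (whether `C*Δ_kC` meets the hypotheses with `M₂e^{−κ′w} < γ` at the §5 corridor width is the in-edge N06); the class edition of §5 itself is
NOT typed (plan g81, 2026-08-28: port not commissioned beyond definition-free pieces); N08 NOT discharged; count-neutral; nothing continuum / OS /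
mass-gap / Clay.
-/

noncomputable section

open Finset Matrix MeasureTheory ProbabilityTheory WithLp
open scoped BigOperators ENNReal MatrixOrder

namespace Literature.MathematicalPhysics.QuantumFieldTheory.Balaban1983to89.B1Eq324BenfattoClassDecoupling

open Literature.MathematicalPhysics.QuantumFieldTheory
open Literature.MathematicalPhysics.QuantumFieldTheory.GaussianToolkit
open Literature.MathematicalPhysics.QuantumFieldTheory.Balaban1983to89.B1Eq324BenfattoClassAppendixC
open Literature.MathematicalPhysics.QuantumFieldTheory.Balaban1983to89.B1Eq324BenfattoClassMarkov

/-! ## §1  Splitting a symmetric form along a partition: the cross part is small, the block-diagonal part stays coercive -/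

section MatrixPart

variable {m σ : Type*} [Fintype m] [DecidableEq m] [Fintype σ] [DecidableEq σ]

omit [DecidableEq m] [Fintype σ] in
/-- **The cross part of a symmetric kernel is form-small (Schur's test)**: for `B` symmetric and a part map `π`, if every row of `|B|`
restricted to the OTHER parts sums to at most `ε`, then `|Σ_{π y ≠ π y′} B y y′ x_y x_{y′}| ≤ ε‖x‖²`.
[cite: HornJohnson2013, §5.6 (Schur test / absolute row-sum bound for the norm of a symmetric matrix)] -/
theorem abs_form_cross_le {B : Matrix m m ℝ} (hB : ∀ y y', B y y' = B y' y) (π : m → σ) {ε : ℝ}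
    (hε : ∀ y, ∑ y', (if π y = π y' then (0 : ℝ) else |B y y'|) ≤ ε) (x : m → ℝ) :
    |∑ y, ∑ y', (if π y = π y' then (0 : ℝ) else B y y') * x y * x y'| ≤ ε * ∑ y, x y ^ 2 := by
  set w : m → m → ℝ := fun y y' => if π y = π y' then (0 : ℝ) else |B y y'| with hw
  have hwsymm : ∀ y y', w y y' = w y' y := by
    intro y y'
    simp only [hw]
    by_cases h : π y = π y'
    · rw [if_pos h, if_pos h.symm]
    · rw [if_neg h, if_neg (fun h' => h h'.symm), hB y y']
  have hterm : ∀ y y', |(if π y = π y' then (0 : ℝ) else B y y') * x y * x y'| ≤ w y y' * ((x y ^ 2 + x y' ^ 2) / 2) := by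
    intro y y'
    simp only [hw]
    by_cases h : π y = π y'
    · rw [if_pos h, if_pos h]; simp
    · rw [if_neg h, if_neg h, abs_mul, abs_mul]
      have hamgm : |x y| * |x y'| ≤ (x y ^ 2 + x y' ^ 2) / 2 := by
        nlinarith [sq_nonneg (|x y| - |x y'|), sq_abs (x y), sq_abs (x y')]
      calc |B y y'| * |x y| * |x y'| = |B y y'| * (|x y| * |x y'|) := by ring
        _ ≤ |B y y'| * ((x y ^ 2 + x y' ^ 2) / 2) := mul_le_mul_of_nonneg_left hamgm (abs_nonneg _)
  have hA1 : ∑ y, ∑ y', w y y' * x y ^ 2 ≤ ε * ∑ y, x y ^ 2 := by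
    calc ∑ y, ∑ y', w y y' * x y ^ 2 = ∑ y, (∑ y', w y y') * x y ^ 2 := by
          refine Finset.sum_congr rfl fun y _ => ?_
          rw [Finset.sum_mul]
      _ ≤ ∑ y, ε * x y ^ 2 := Finset.sum_le_sum fun y _ => mul_le_mul_of_nonneg_right (hε y) (sq_nonneg _)
      _ = ε * ∑ y, x y ^ 2 := by rw [Finset.mul_sum]
  have hA2 : ∑ y, ∑ y', w y y' * x y' ^ 2 ≤ ε * ∑ y, x y ^ 2 := by
    rw [Finset.sum_comm]
    calc ∑ y', ∑ y, w y y' * x y' ^ 2 = ∑ y', (∑ y, w y y') * x y' ^ 2 := by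
          refine Finset.sum_congr rfl fun y' _ => ?_
          rw [Finset.sum_mul]
      _ ≤ ∑ y', ε * x y' ^ 2 := by
          refine Finset.sum_le_sum fun y' _ => mul_le_mul_of_nonneg_right ?_ (sq_nonneg _)
          calc ∑ y, w y y' = ∑ y, w y' y := Finset.sum_congr rfl fun y _ => hwsymm y y'
            _ ≤ ε := hε y'
      _ = ε * ∑ y, x y ^ 2 := by rw [Finset.mul_sum]
  have hsum : ∑ y, ∑ y', w y y' * ((x y ^ 2 + x y' ^ 2) / 2)
      = ((∑ y, ∑ y', w y y' * x y ^ 2) + ∑ y, ∑ y', w y y' * x y' ^ 2) / 2 := by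
    rw [← Finset.sum_add_distrib, Finset.sum_div]
    refine Finset.sum_congr rfl fun y _ => ?_
    rw [← Finset.sum_add_distrib, Finset.sum_div]
    refine Finset.sum_congr rfl fun y' _ => ?_
    ring
  calc |∑ y, ∑ y', (if π y = π y' then (0 : ℝ) else B y y') * x y * x y'|
      ≤ ∑ y, |∑ y', (if π y = π y' then (0 : ℝ) else B y y') * x y * x y'| := Finset.abs_sum_le_sum_abs _ _
    _ ≤ ∑ y, ∑ y', |(if π y = π y' then (0 : ℝ) else B y y') * x y * x y'| :=
        Finset.sum_le_sum fun y _ => Finset.abs_sum_le_sum_abs _ _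
    _ ≤ ∑ y, ∑ y', w y y' * ((x y ^ 2 + x y' ^ 2) / 2) :=
        Finset.sum_le_sum fun y _ => Finset.sum_le_sum fun y' _ => hterm y y'
    _ ≤ ε * ∑ y, x y ^ 2 := by rw [hsum]; linarith

omit [DecidableEq m] [Fintype σ] in
/-- The form splits into its block-diagonal and cross parts. [cite: HornJohnson2013, §0.7.2 (conformal partitions)] -/
theorem form_eq_blockDiag_add_cross (B : Matrix m m ℝ) (π : m → σ) (x : m → ℝ) :
    ∑ y, ∑ y', B y y' * x y * x y' =
      (∑ y, ∑ y', (if π y = π y' then B y y' else 0) * x y * x y') +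
        ∑ y, ∑ y', (if π y = π y' then (0 : ℝ) else B y y') * x y * x y' := by
  rw [← Finset.sum_add_distrib]
  refine Finset.sum_congr rfl fun y _ => ?_
  rw [← Finset.sum_add_distrib]
  refine Finset.sum_congr rfl fun y' _ => ?_
  split_ifs <;> ring

omit [DecidableEq m] in
/-- **The block-diagonal part of a coercive form is coercive with the SAME constant**: each block is a principal sub-form (evaluate the
form at the vector restricted to one part, then sum over the parts). [cite: HornJohnson2013, Thm 4.3.28 (interlacing; lower bound only)] -/
theorem coercive_blockDiag {B : Matrix m m ℝ} (π : m → σ) {γ : ℝ}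
    (hγ : ∀ x : m → ℝ, γ * ∑ y, x y ^ 2 ≤ ∑ y, ∑ y', B y y' * x y * x y') (x : m → ℝ) :
    γ * ∑ y, x y ^ 2 ≤ ∑ y, ∑ y', (if π y = π y' then B y y' else 0) * x y * x y' := by
  have hpart : ∀ s : σ, γ * ∑ y, (if π y = s then x y else 0) ^ 2 ≤
      ∑ y, ∑ y', B y y' * (if π y = s then x y else 0) * (if π y' = s then x y' else 0) := fun s => hγ _
  have hsum := Finset.sum_le_sum fun s (_ : s ∈ (Finset.univ : Finset σ)) => hpart s
  have hone : ∀ y, ∑ s, (if π y = s then x y else 0) ^ 2 = x y ^ 2 := by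
    intro y
    rw [Finset.sum_eq_single (π y)]
    · rw [if_pos rfl]
    · intro s _ hs
      rw [if_neg (Ne.symm hs)]
      ring
    · intro h
      exact absurd (Finset.mem_univ _) h
  have hL : ∑ s, γ * ∑ y, (if π y = s then x y else 0) ^ 2 = γ * ∑ y, x y ^ 2 := by
    rw [← Finset.mul_sum, Finset.sum_comm]
    congr 1
    exact Finset.sum_congr rfl fun y _ => hone y
  have hR : ∑ s, ∑ y, ∑ y', B y y' * (if π y = s then x y else 0) * (if π y' = s then x y' else 0)
      = ∑ y, ∑ y', (if π y = π y' then B y y' else 0) * x y * x y' := by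
    rw [Finset.sum_comm]
    refine Finset.sum_congr rfl fun y _ => ?_
    rw [Finset.sum_comm]
    refine Finset.sum_congr rfl fun y' _ => ?_
    rw [Finset.sum_eq_single (π y)]
    · rw [if_pos rfl]
      by_cases h : π y = π y'
      · rw [if_pos h.symm, if_pos h]
      · rw [if_neg (fun h' => h h'.symm), if_neg h]
        ring
    · intro s _ hs
      rw [if_neg (Ne.symm hs)]
      ring
    · intro h
      exact absurd (Finset.mem_univ _) h
  calc γ * ∑ y, x y ^ 2 = ∑ s, γ * ∑ y, (if π y = s then x y else 0) ^ 2 := hL.symm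
    _ ≤ ∑ s, ∑ y, ∑ y', B y y' * (if π y = s then x y else 0) * (if π y' = s then x y' else 0) := hsum
    _ = _ := hR

omit [DecidableEq m] in
/-- **Two-sided form comparison between a coercive symmetric kernel and its block-diagonal part**: with `γ`-coercivity and cross row
sums `≤ ε`, `(1 − ε/γ)⟨x, B_bd x⟩ ≤ ⟨x, Bx⟩ ≤ (1 + ε/γ)⟨x, B_bd x⟩`.  Applied to the conditional precision `B = A|_{Γᶜ}` of the class of
`B1Eq324BenfattoClassAppendixC` and the partition of `Γᶜ` into the boxes of [BenfattoEtAl1978] §5, this is the quantitative substitute for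
the Markov factorisation (5.13) p. 155, UNIFORM in `Γ`. [cite: BenfattoEtAl1978, (5.13) p.155 (class substitute; ours)] -/
theorem form_blockDiag_two_sided {B : Matrix m m ℝ} (hB : ∀ y y', B y y' = B y' y) (π : m → σ) {γ ε : ℝ} (hγ0 : 0 < γ)
    (hγ : ∀ x : m → ℝ, γ * ∑ y, x y ^ 2 ≤ ∑ y, ∑ y', B y y' * x y * x y')
    (hε : ∀ y, ∑ y', (if π y = π y' then (0 : ℝ) else |B y y'|) ≤ ε) (x : m → ℝ) :
    (1 - ε / γ) * ∑ y, ∑ y', (if π y = π y' then B y y' else 0) * x y * x y' ≤ ∑ y, ∑ y', B y y' * x y * x y' ∧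
      ∑ y, ∑ y', B y y' * x y * x y' ≤ (1 + ε / γ) * ∑ y, ∑ y', (if π y = π y' then B y y' else 0) * x y * x y' := by
  have hbd := coercive_blockDiag π hγ x
  have hcross := abs_form_cross_le hB π hε x
  rw [form_eq_blockDiag_add_cross B π x]
  set D := ∑ y, ∑ y', (if π y = π y' then B y y' else 0) * x y * x y' with hD
  set X := ∑ y, ∑ y', (if π y = π y' then (0 : ℝ) else B y y') * x y * x y' with hX
  have hX' : |X| ≤ ε / γ * D := by
    calc |X| ≤ ε * ∑ y, x y ^ 2 := hcross
      _ = ε / γ * (γ * ∑ y, x y ^ 2) := by field_simp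
      _ ≤ ε / γ * D := by
          rcases isEmpty_or_nonempty m with hm | hm
          · have hD0 : D = 0 := by simp [hD]
            have hS0 : ∑ y, x y ^ 2 = 0 := by simp
            rw [hD0, hS0]; simp
          · refine mul_le_mul_of_nonneg_left hbd ?_
            have hε0 : 0 ≤ ε := le_trans (Finset.sum_nonneg fun y' _ => by
              split_ifs
              · exact le_rfl
              · exact abs_nonneg _) (hε (Classical.arbitrary m))
            positivity
  constructor
  · have := neg_abs_le X; nlinarith
  · have := le_abs_self X; nlinarith

omit [DecidableEq m] [Fintype σ] [DecidableEq σ] in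
/-- **Cross row sums are exponentially small across `w`-separated parts**: if `Σ_{y′} |B y y′|e^{κ′·dist y y′} ≤ M₂` and different parts are at
distance `≥ w`, then `Σ_{π y′ ≠ π y} |B y y′| ≤ M₂e^{−κ′w}`. [cite: BenfattoEtAl1978, (5.13) p.155 (class substitute; ours)] -/
theorem cross_rowSum_le_exp {B : Matrix m m ℝ} (π : m → σ) [DecidableEq σ] {dist : m → m → ℝ} {κ' w M₂ : ℝ}
    (hκ : 0 ≤ κ') (hM : ∀ y, ∑ y', |B y y'| * Real.exp (κ' * dist y y') ≤ M₂)
    (hsep : ∀ y y', π y ≠ π y' → w ≤ dist y y') (y : m) :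
    ∑ y', (if π y = π y' then (0 : ℝ) else |B y y'|) ≤ M₂ * Real.exp (-(κ' * w)) := by
  have hterm : ∀ y', (if π y = π y' then (0 : ℝ) else |B y y'|) ≤
      |B y y'| * Real.exp (κ' * dist y y') * Real.exp (-(κ' * w)) := by
    intro y'
    by_cases h : π y = π y'
    · rw [if_pos h]; positivity
    · rw [if_neg h]
      have hw := hsep y y' h
      have hexp : 1 ≤ Real.exp (κ' * dist y y') * Real.exp (-(κ' * w)) := by
        rw [← Real.exp_add]
        exact Real.one_le_exp (by nlinarith)
      calc |B y y'| = |B y y'| * 1 := (mul_one _).symm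
        _ ≤ |B y y'| * (Real.exp (κ' * dist y y') * Real.exp (-(κ' * w))) :=
            mul_le_mul_of_nonneg_left hexp (abs_nonneg _)
        _ = _ := by ring
  calc ∑ y', (if π y = π y' then (0 : ℝ) else |B y y'|)
      ≤ ∑ y', |B y y'| * Real.exp (κ' * dist y y') * Real.exp (-(κ' * w)) := Finset.sum_le_sum fun y' _ => hterm y'
    _ = (∑ y', |B y y'| * Real.exp (κ' * dist y y')) * Real.exp (-(κ' * w)) := by rw [Finset.sum_mul]
    _ ≤ M₂ * Real.exp (-(κ' * w)) := mul_le_mul_of_nonneg_right (hM y) (Real.exp_pos _).le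

end MatrixPart

/-! ## §2  Gaussian domination under a two-sided comparison of precisions (generic) -/

section Gaussian

variable {ι : Type*} [Fintype ι] [DecidableEq ι]

omit [DecidableEq ι] in
/-- A positive multiple of a positive definite real matrix is positive definite. [cite: HornJohnson2013, Obs. 7.1.3] -/
theorem posDef_smul_of_pos {P : Matrix ι ι ℝ} (hP : P.PosDef) {c : ℝ} (hc : 0 < c) : (c • P).PosDef := by
  refine Matrix.PosDef.of_dotProduct_mulVec_pos ?_ fun x hx => ?_
  · have h := hP.isHermitian
    rw [Matrix.IsHermitian, Matrix.conjTranspose_smul, star_trivial, h]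
  · have h := hP.dotProduct_mulVec_pos hx
    rw [Matrix.smul_mulVec, dotProduct_smul, smul_eq_mul]
    simp only [star_trivial] at h ⊢
    exact mul_pos hc h

omit [DecidableEq ι] in
/-- The Gaussian weight of a scaled precision is the weight at the scaled point: `w_{cP}(y) = w_P(√c·y)` (`c ≥ 0`).
[cite: HornJohnson2013, §7.1 (quadratic forms; scaling)] -/
theorem gaussWeight_smul {P : Matrix ι ι ℝ} {c : ℝ} (hc : 0 ≤ c) (y : EuclideanSpace ℝ ι) :
    gaussWeight (c • P) y = gaussWeight P (Real.sqrt c • y) := by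
  simp only [gaussWeight]
  have h1 : ofLp y ⬝ᵥ (c • P) *ᵥ ofLp y = c * (ofLp y ⬝ᵥ P *ᵥ ofLp y) := by
    rw [Matrix.smul_mulVec, dotProduct_smul, smul_eq_mul]
  have h2 : ofLp (Real.sqrt c • y) ⬝ᵥ P *ᵥ ofLp (Real.sqrt c • y) = c * (ofLp y ⬝ᵥ P *ᵥ ofLp y) := by
    rw [WithLp.ofLp_smul, Matrix.mulVec_smul, dotProduct_smul, smul_dotProduct, smul_eq_mul, smul_eq_mul, ← mul_assoc,
      Real.mul_self_sqrt hc]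
  rw [h1, h2]

omit [DecidableEq ι] in
/-- **Scaling of the Gaussian integral**: `Z_{cP} = (√c)^{−|ι|} Z_P` for `c > 0`. [cite: HornJohnson2013, §7.1 (quadratic forms; scaling)] -/
theorem gaussZ_smul {P : Matrix ι ι ℝ} {c : ℝ} (hc : 0 < c) :
    gaussZ (c • P) = ENNReal.ofReal ((Real.sqrt c ^ Fintype.card ι)⁻¹) * gaussZ P := by
  have hsc : Real.sqrt c ≠ 0 := (Real.sqrt_pos.2 hc).ne'
  simp only [gaussZ]
  simp_rw [gaussWeight_smul hc.le]
  rw [lintegral_comp_smul volume (gaussWeight P) hsc, finrank_euclideanSpace, abs_of_pos (by positivity)]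

/-- Expectation under the centred Gaussian of precision `P` as a weighted Lebesgue integral:
`∫F dN(0,P⁻¹) = Z_P⁻¹ ∫ F·w_P`. [cite: HornJohnson2013, §7.1 (positive definite quadratic forms)] -/
theorem lintegral_multivariateGaussian_inv_eq {P : Matrix ι ι ℝ} (hP : P.PosDef) (F : EuclideanSpace ℝ ι → ℝ≥0∞)
    (hF : Measurable F) :
    ∫⁻ y, F y ∂(multivariateGaussian 0 P⁻¹) = (gaussZ P)⁻¹ * ∫⁻ y, gaussWeight P y * F y := by
  obtain ⟨hμ, -, -⟩ := multivariateGaussian_inv_eq_withDensity hP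
  rw [hμ, lintegral_smul_measure, lintegral_withDensity_eq_lintegral_mul _ (measurable_gaussWeight P) hF]
  rfl

/-- **GAUSSIAN DOMINATION, upper**: if two positive definite precisions satisfy `(1−δ)⟨y,P₂y⟩ ≤ ⟨y,P₁y⟩ ≤ (1+δ)⟨y,P₂y⟩` (`0 ≤ δ < 1`), then
for every measurable `F ≥ 0`, `∫F dN(0,P₁⁻¹) ≤ (√((1+δ)/(1−δ)))^{|ι|} ∫F dN(0,((1−δ)P₂)⁻¹)` — compare the densities pointwise and the
normalisations by scaling; no Hölder, no determinant. [cite: BenfattoEtAl1978, (5.13) p.155 (class substitute; ours)] -/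
theorem lintegral_multivariateGaussian_le_of_form_le {P₁ P₂ : Matrix ι ι ℝ} (hP₁ : P₁.PosDef) (hP₂ : P₂.PosDef)
    {δ : ℝ} (hδ0 : 0 ≤ δ) (hδ1 : δ < 1)
    (hlow : ∀ v : ι → ℝ, (1 - δ) * (v ⬝ᵥ P₂ *ᵥ v) ≤ v ⬝ᵥ P₁ *ᵥ v)
    (hup : ∀ v : ι → ℝ, v ⬝ᵥ P₁ *ᵥ v ≤ (1 + δ) * (v ⬝ᵥ P₂ *ᵥ v))
    (F : EuclideanSpace ℝ ι → ℝ≥0∞) (hF : Measurable F) :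
    ∫⁻ y, F y ∂(multivariateGaussian 0 P₁⁻¹) ≤
      ENNReal.ofReal ((Real.sqrt (1 + δ) / Real.sqrt (1 - δ)) ^ Fintype.card ι) *
        ∫⁻ y, F y ∂(multivariateGaussian 0 ((1 - δ) • P₂)⁻¹) := by
  have h1δ : 0 < 1 - δ := by linarith
  have h1δ' : 0 < 1 + δ := by linarith
  have hPm : ((1 - δ) • P₂).PosDef := posDef_smul_of_pos hP₂ h1δ
  have hPp : ((1 + δ) • P₂).PosDef := posDef_smul_of_pos hP₂ h1δ'
  obtain ⟨-, hZ0, hZtop⟩ := multivariateGaussian_inv_eq_withDensity hP₂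
  obtain ⟨-, hZm0, hZmtop⟩ := multivariateGaussian_inv_eq_withDensity hPm
  obtain ⟨-, hZp0, hZptop⟩ := multivariateGaussian_inv_eq_withDensity hPp
  -- pointwise comparison of the weights
  have hw_up : ∀ y, gaussWeight P₁ y ≤ gaussWeight ((1 - δ) • P₂) y := by
    intro y
    simp only [gaussWeight]
    apply ENNReal.ofReal_le_ofReal
    apply Real.exp_le_exp.2
    rw [Matrix.smul_mulVec, dotProduct_smul, smul_eq_mul]
    have := hlow (ofLp y)
    linarith
  have hw_low : ∀ y, gaussWeight ((1 + δ) • P₂) y ≤ gaussWeight P₁ y := by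
    intro y
    simp only [gaussWeight]
    apply ENNReal.ofReal_le_ofReal
    apply Real.exp_le_exp.2
    rw [Matrix.smul_mulVec, dotProduct_smul, smul_eq_mul]
    have := hup (ofLp y)
    linarith
  -- normalisations
  have hZ1_ge : gaussZ ((1 + δ) • P₂) ≤ gaussZ P₁ := lintegral_mono hw_low
  have hI : ∫⁻ y, gaussWeight P₁ y * F y ≤ ∫⁻ y, gaussWeight ((1 - δ) • P₂) y * F y :=
    lintegral_mono fun y => mul_le_mul_left (hw_up y) _
  rw [lintegral_multivariateGaussian_inv_eq hP₁ F hF, lintegral_multivariateGaussian_inv_eq hPm F hF]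
  -- `Z₁⁻¹ ∫ w₁F ≤ Z₊⁻¹ ∫ w₋F = (Z₊⁻¹ Z₋) · (Z₋⁻¹ ∫ w₋F)`
  have hstep : (gaussZ P₁)⁻¹ * ∫⁻ y, gaussWeight P₁ y * F y ≤
      (gaussZ ((1 + δ) • P₂))⁻¹ * ∫⁻ y, gaussWeight ((1 - δ) • P₂) y * F y :=
    mul_le_mul' (ENNReal.inv_le_inv.2 hZ1_ge) hI
  refine hstep.trans (le_of_eq ?_)
  -- the ratio of normalisations
  have hratio : (gaussZ ((1 + δ) • P₂))⁻¹ =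
      ENNReal.ofReal ((Real.sqrt (1 + δ) / Real.sqrt (1 - δ)) ^ Fintype.card ι) * (gaussZ ((1 - δ) • P₂))⁻¹ := by
    rw [gaussZ_smul h1δ', gaussZ_smul h1δ, ENNReal.mul_inv (Or.inr hZtop) (Or.inr hZ0),
      ENNReal.mul_inv (Or.inr hZtop) (Or.inr hZ0), ← mul_assoc]
    congr 1
    have hs1 : 0 < Real.sqrt (1 + δ) ^ Fintype.card ι := by positivity
    have hs2 : 0 < Real.sqrt (1 - δ) ^ Fintype.card ι := by positivity
    rw [← ENNReal.ofReal_inv_of_pos (by positivity), inv_inv, ← ENNReal.ofReal_inv_of_pos (by positivity), inv_inv,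
      ← ENNReal.ofReal_mul (by positivity)]
    congr 1
    rw [div_pow]
    field_simp
  rw [hratio, mul_assoc]

/-- **GAUSSIAN DOMINATION, lower**: under the same comparison, `∫F dN(0,P₁⁻¹) ≥ (√((1−δ)/(1+δ)))^{|ι|} ∫F dN(0,((1+δ)P₂)⁻¹)`.
[cite: BenfattoEtAl1978, (5.13) p.155 (class substitute; ours)] -/
theorem lintegral_multivariateGaussian_ge_of_form_le {P₁ P₂ : Matrix ι ι ℝ} (hP₁ : P₁.PosDef) (hP₂ : P₂.PosDef)
    {δ : ℝ} (hδ0 : 0 ≤ δ) (hδ1 : δ < 1)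
    (hlow : ∀ v : ι → ℝ, (1 - δ) * (v ⬝ᵥ P₂ *ᵥ v) ≤ v ⬝ᵥ P₁ *ᵥ v)
    (hup : ∀ v : ι → ℝ, v ⬝ᵥ P₁ *ᵥ v ≤ (1 + δ) * (v ⬝ᵥ P₂ *ᵥ v))
    (F : EuclideanSpace ℝ ι → ℝ≥0∞) (hF : Measurable F) :
    ENNReal.ofReal ((Real.sqrt (1 - δ) / Real.sqrt (1 + δ)) ^ Fintype.card ι) *
        ∫⁻ y, F y ∂(multivariateGaussian 0 ((1 + δ) • P₂)⁻¹) ≤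
      ∫⁻ y, F y ∂(multivariateGaussian 0 P₁⁻¹) := by
  have h1δ : 0 < 1 - δ := by linarith
  have h1δ' : 0 < 1 + δ := by linarith
  have hPm : ((1 - δ) • P₂).PosDef := posDef_smul_of_pos hP₂ h1δ
  have hPp : ((1 + δ) • P₂).PosDef := posDef_smul_of_pos hP₂ h1δ'
  obtain ⟨-, hZ0, hZtop⟩ := multivariateGaussian_inv_eq_withDensity hP₂
  have hw_up : ∀ y, gaussWeight P₁ y ≤ gaussWeight ((1 - δ) • P₂) y := by
    intro y
    simp only [gaussWeight]
    apply ENNReal.ofReal_le_ofReal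
    apply Real.exp_le_exp.2
    rw [Matrix.smul_mulVec, dotProduct_smul, smul_eq_mul]
    have := hlow (ofLp y)
    linarith
  have hw_low : ∀ y, gaussWeight ((1 + δ) • P₂) y ≤ gaussWeight P₁ y := by
    intro y
    simp only [gaussWeight]
    apply ENNReal.ofReal_le_ofReal
    apply Real.exp_le_exp.2
    rw [Matrix.smul_mulVec, dotProduct_smul, smul_eq_mul]
    have := hup (ofLp y)
    linarith
  have hZ1_le : gaussZ P₁ ≤ gaussZ ((1 - δ) • P₂) := lintegral_mono hw_up
  have hI : ∫⁻ y, gaussWeight ((1 + δ) • P₂) y * F y ≤ ∫⁻ y, gaussWeight P₁ y * F y :=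
    lintegral_mono fun y => mul_le_mul_left (hw_low y) _
  rw [lintegral_multivariateGaussian_inv_eq hP₁ F hF, lintegral_multivariateGaussian_inv_eq hPp F hF]
  have hstep : (gaussZ ((1 - δ) • P₂))⁻¹ * ∫⁻ y, gaussWeight ((1 + δ) • P₂) y * F y ≤
      (gaussZ P₁)⁻¹ * ∫⁻ y, gaussWeight P₁ y * F y :=
    mul_le_mul' (ENNReal.inv_le_inv.2 hZ1_le) hI
  refine le_trans (le_of_eq ?_) hstep
  have hratio : ENNReal.ofReal ((Real.sqrt (1 - δ) / Real.sqrt (1 + δ)) ^ Fintype.card ι) * (gaussZ ((1 + δ) • P₂))⁻¹ =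
      (gaussZ ((1 - δ) • P₂))⁻¹ := by
    rw [gaussZ_smul h1δ', gaussZ_smul h1δ, ENNReal.mul_inv (Or.inr hZtop) (Or.inr hZ0),
      ENNReal.mul_inv (Or.inr hZtop) (Or.inr hZ0), ← mul_assoc]
    congr 1
    rw [← ENNReal.ofReal_inv_of_pos (by positivity), inv_inv, ← ENNReal.ofReal_inv_of_pos (by positivity), inv_inv,
      ← ENNReal.ofReal_mul (by positivity)]
    congr 1
    rw [div_pow]
    field_simp
  rw [← mul_assoc, hratio]

/-- A multivariate Gaussian with mean `m` is the translate by `m` of the centred one (Mathlib's definition pushes the standard Gaussian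
forward under `x ↦ m + √S x`). [cite: HornJohnson2013, §7.1 (positive definite quadratic forms)] -/
theorem multivariateGaussian_eq_map_add (m : EuclideanSpace ℝ ι) (S : Matrix ι ι ℝ) :
    multivariateGaussian m S = (multivariateGaussian 0 S).map (fun x => m + x) := by
  simp only [multivariateGaussian]
  rw [Measure.map_map (measurable_const_add m)]
  · congr 1
    funext x
    simp
  · exact (continuous_const.add (ContinuousLinearMap.continuous _)).measurable

/-- **Gaussian domination with a common mean** (upper): the translate of `lintegral_multivariateGaussian_le_of_form_le` — the conditional
centre `m` (the regression of `B1Eq324BenfattoClassAppendixC.regression_apply_eq`) rides along unchanged.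
[cite: BenfattoEtAl1978, (5.13) p.155 (class substitute; ours)] -/
theorem lintegral_multivariateGaussian_mean_le_of_form_le {P₁ P₂ : Matrix ι ι ℝ} (hP₁ : P₁.PosDef) (hP₂ : P₂.PosDef)
    {δ : ℝ} (hδ0 : 0 ≤ δ) (hδ1 : δ < 1)
    (hlow : ∀ v : ι → ℝ, (1 - δ) * (v ⬝ᵥ P₂ *ᵥ v) ≤ v ⬝ᵥ P₁ *ᵥ v)
    (hup : ∀ v : ι → ℝ, v ⬝ᵥ P₁ *ᵥ v ≤ (1 + δ) * (v ⬝ᵥ P₂ *ᵥ v))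
    (m : EuclideanSpace ℝ ι) (F : EuclideanSpace ℝ ι → ℝ≥0∞) (hF : Measurable F) :
    ∫⁻ y, F y ∂(multivariateGaussian m P₁⁻¹) ≤
      ENNReal.ofReal ((Real.sqrt (1 + δ) / Real.sqrt (1 - δ)) ^ Fintype.card ι) *
        ∫⁻ y, F y ∂(multivariateGaussian m ((1 - δ) • P₂)⁻¹) := by
  rw [multivariateGaussian_eq_map_add m P₁⁻¹, multivariateGaussian_eq_map_add m ((1 - δ) • P₂)⁻¹,
    lintegral_map hF (measurable_const_add m), lintegral_map hF (measurable_const_add m)]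
  exact lintegral_multivariateGaussian_le_of_form_le hP₁ hP₂ hδ0 hδ1 hlow hup (fun x => F (m + x))
    (hF.comp (measurable_const_add m))

/-- **Gaussian domination with a common mean** (lower). [cite: BenfattoEtAl1978, (5.13) p.155 (class substitute; ours)] -/
theorem lintegral_multivariateGaussian_mean_ge_of_form_le {P₁ P₂ : Matrix ι ι ℝ} (hP₁ : P₁.PosDef) (hP₂ : P₂.PosDef)
    {δ : ℝ} (hδ0 : 0 ≤ δ) (hδ1 : δ < 1)
    (hlow : ∀ v : ι → ℝ, (1 - δ) * (v ⬝ᵥ P₂ *ᵥ v) ≤ v ⬝ᵥ P₁ *ᵥ v)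
    (hup : ∀ v : ι → ℝ, v ⬝ᵥ P₁ *ᵥ v ≤ (1 + δ) * (v ⬝ᵥ P₂ *ᵥ v))
    (m : EuclideanSpace ℝ ι) (F : EuclideanSpace ℝ ι → ℝ≥0∞) (hF : Measurable F) :
    ENNReal.ofReal ((Real.sqrt (1 - δ) / Real.sqrt (1 + δ)) ^ Fintype.card ι) *
        ∫⁻ y, F y ∂(multivariateGaussian m ((1 + δ) • P₂)⁻¹) ≤
      ∫⁻ y, F y ∂(multivariateGaussian m P₁⁻¹) := by
  rw [multivariateGaussian_eq_map_add m P₁⁻¹, multivariateGaussian_eq_map_add m ((1 + δ) • P₂)⁻¹,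
    lintegral_map hF (measurable_const_add m), lintegral_map hF (measurable_const_add m)]
  exact lintegral_multivariateGaussian_ge_of_form_le hP₁ hP₂ hδ0 hδ1 hlow hup (fun x => F (m + x))
    (hF.comp (measurable_const_add m))

end Gaussian

/-! ## §3  The decoupling estimate: a Gaussian vector with a coercive, exponentially decaying precision is dominated, both ways, by the
Gaussian vector with the BLOCK-DIAGONAL precision along any partition into `w`-separated parts, at temperatures `(1 ∓ δ)`,
`δ = M₂e^{−κ′w}/γ` -/

section Decoupling

variable {m σ : Type*} [Fintype m] [DecidableEq m] [Fintype σ] [DecidableEq σ]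

omit [DecidableEq m] in
/-- The block-diagonal part of a symmetric coercive kernel is positive definite. [cite: HornJohnson2013, Thm 4.3.28 with §7.1 (7.1.1)] -/
theorem posDef_blockDiag {B : Matrix m m ℝ} (hB : ∀ y y', B y y' = B y' y) (π : m → σ) {γ : ℝ} (hγ0 : 0 < γ)
    (hγ : ∀ x : m → ℝ, γ * ∑ y, x y ^ 2 ≤ ∑ y, ∑ y', B y y' * x y * x y') :
    (Matrix.of fun y y' => if π y = π y' then B y y' else 0 : Matrix m m ℝ).PosDef := by
  refine posDef_of_coercive (fun y y' => ?_) hγ0 fun x => ?_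
  · simp only [Matrix.of_apply]
    by_cases h : π y = π y'
    · rw [if_pos h, if_pos h.symm, hB y y']
    · rw [if_neg h, if_neg (fun h' => h h'.symm)]
  · simpa only [Matrix.of_apply] using coercive_blockDiag π hγ x

/-- **THE DECOUPLING ESTIMATE (precision form).**  Let `B` be a symmetric `γ`-coercive precision on a finite index set `m` with
`Σ_{y′}|B y y′|e^{κ′·dist y y′} ≤ M₂` (`κ′ ≥ 0`), and `π : m → σ` a partition whose parts are pairwise at `dist ≥ w`, with
`δ := M₂e^{−κ′w}/γ < 1`.  Then the quadratic forms of `B` and of its block-diagonal part `B_bd` satisfy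
`(1−δ)⟨x,B_bd x⟩ ≤ ⟨x,Bx⟩ ≤ (1+δ)⟨x,B_bd x⟩`, and for every measurable `F ≥ 0` on `ℝ^m`
`(√((1−δ)/(1+δ)))^{|m|} ∫F dN(0,((1+δ)B_bd)⁻¹) ≤ ∫F dN(0,B⁻¹) ≤ (√((1+δ)/(1−δ)))^{|m|} ∫F dN(0,((1−δ)B_bd)⁻¹)`.
At `B = A|_{Γᶜ}` (the conditional precision given the corridor variables of [BenfattoEtAl1978] §5, for a field in the class of
`B1Eq324BenfattoClassAppendixC`; `B⁻¹ = C^Γ` by `schur_eq_inv_submatrix_compl`) and `π` = «the box containing the site», this REPLACES the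
Markov factorisation (5.13) p. 155: under `N(0,(cB_bd)⁻¹)` the box blocks have block-diagonal precision (independent boxes, each with the
Dirichlet box precision `cA|_□`), and both the prefactor `((1+δ)/(1−δ))^{|Γᶜ|/2} ≤ e^{|Γᶜ|·2δ/(1−δ)}` and the temperatures are `1 + O(M₂e^{−κ′w}/γ)` —
of `errTerm` shape `|I|·S·e^{−ρ₃b^{3/2}}` at corridor width `w ≍ b^{3/2}`. [cite: BenfattoEtAl1978, (5.13) p.155 (class substitute; ours)] -/
theorem decoupling {B : Matrix m m ℝ} (hB : ∀ y y', B y y' = B y' y) (π : m → σ) {dist : m → m → ℝ}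
    {γ κ' w M₂ : ℝ} (hγ0 : 0 < γ) (hκ : 0 ≤ κ') (hM₂ : 0 ≤ M₂)
    (hγ : ∀ x : m → ℝ, γ * ∑ y, x y ^ 2 ≤ ∑ y, ∑ y', B y y' * x y * x y')
    (hM : ∀ y, ∑ y', |B y y'| * Real.exp (κ' * dist y y') ≤ M₂)
    (hsep : ∀ y y', π y ≠ π y' → w ≤ dist y y') (hδ1 : M₂ * Real.exp (-(κ' * w)) < γ)
    (F : EuclideanSpace ℝ m → ℝ≥0∞) (hF : Measurable F) :
    let δ : ℝ := M₂ * Real.exp (-(κ' * w)) / γ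
    let Bbd : Matrix m m ℝ := Matrix.of fun y y' => if π y = π y' then B y y' else 0
    (∀ x : m → ℝ, (1 - δ) * (x ⬝ᵥ Bbd *ᵥ x) ≤ x ⬝ᵥ B *ᵥ x ∧ x ⬝ᵥ B *ᵥ x ≤ (1 + δ) * (x ⬝ᵥ Bbd *ᵥ x)) ∧
      ENNReal.ofReal ((Real.sqrt (1 - δ) / Real.sqrt (1 + δ)) ^ Fintype.card m) *
          ∫⁻ y, F y ∂(multivariateGaussian 0 ((1 + δ) • Bbd)⁻¹) ≤ ∫⁻ y, F y ∂(multivariateGaussian 0 B⁻¹) ∧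
      ∫⁻ y, F y ∂(multivariateGaussian 0 B⁻¹) ≤
        ENNReal.ofReal ((Real.sqrt (1 + δ) / Real.sqrt (1 - δ)) ^ Fintype.card m) *
          ∫⁻ y, F y ∂(multivariateGaussian 0 ((1 - δ) • Bbd)⁻¹) := by
  intro δ Bbd
  -- the cross row sums
  have hε : ∀ y, ∑ y', (if π y = π y' then (0 : ℝ) else |B y y'|) ≤ M₂ * Real.exp (-(κ' * w)) :=
    cross_rowSum_le_exp π hκ hM hsep
  have hform : ∀ v : m → ℝ, v ⬝ᵥ (B *ᵥ v) = ∑ y, ∑ y', B y y' * v y * v y' := by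
    intro v
    simp only [dotProduct, Matrix.mulVec, Finset.mul_sum]
    exact Finset.sum_congr rfl fun e _ => Finset.sum_congr rfl fun e' _ => by ring
  have hformbd : ∀ v : m → ℝ, v ⬝ᵥ (Bbd *ᵥ v) = ∑ y, ∑ y', (if π y = π y' then B y y' else 0) * v y * v y' := by
    intro v
    simp only [dotProduct, Matrix.mulVec, Finset.mul_sum, Bbd, Matrix.of_apply]
    exact Finset.sum_congr rfl fun e _ => Finset.sum_congr rfl fun e' _ => by ring
  have hδdef : δ = M₂ * Real.exp (-(κ' * w)) / γ := rfl
  have htwo : ∀ x : m → ℝ, (1 - δ) * (x ⬝ᵥ Bbd *ᵥ x) ≤ x ⬝ᵥ B *ᵥ x ∧ x ⬝ᵥ B *ᵥ x ≤ (1 + δ) * (x ⬝ᵥ Bbd *ᵥ x) := by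
    intro x
    rw [hform, hformbd, hδdef]
    exact form_blockDiag_two_sided hB π hγ0 hγ hε x
  have hδ0 : 0 ≤ δ := by rw [hδdef]; positivity
  have hδ1' : δ < 1 := by rw [hδdef, div_lt_one hγ0]; exact hδ1
  have hP₁ : B.PosDef := posDef_of_coercive hB hγ0 hγ
  have hP₂ : Bbd.PosDef := posDef_blockDiag hB π hγ0 hγ
  exact ⟨htwo,
    lintegral_multivariateGaussian_ge_of_form_le hP₁ hP₂ hδ0 hδ1' (fun v => (htwo v).1) (fun v => (htwo v).2) F hF,
    lintegral_multivariateGaussian_le_of_form_le hP₁ hP₂ hδ0 hδ1' (fun v => (htwo v).1) (fun v => (htwo v).2) F hF⟩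

/-- **The decoupling estimate at the conditional precision of the class.**  For `A` in the class of `B1Eq324BenfattoClassAppendixC`
(symmetric, `γ`-coercive) with the weighted row bound `Σ_{e′}|A e e′|e^{κ′·dist e e′} ≤ M₂`, a conditioning set `Γ` and a partition `π` of
`Γᶜ` into parts («boxes») pairwise at `dist ≥ w` with `M₂e^{−κ′w} < γ`: the conditional precision `A|_{Γᶜ}` (whose inverse is the
conditional covariance `C^Γ`, `schur_eq_inv_submatrix_compl`) satisfies the three conclusions of `decoupling` with the SAME `δ = M₂e^{−κ′w}/γ` —
UNIFORMLY IN `Γ`. [cite: BenfattoEtAl1978, (5.13) p.155 (class substitute; ours)] -/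
theorem decoupling_conditional {ι : Type*} [Fintype ι] [DecidableEq ι] {A : Matrix ι ι ℝ} (hA : ∀ e e', A e e' = A e' e)
    {dist : ι → ι → ℝ} {γ κ' w M₂ : ℝ} (hγ0 : 0 < γ) (hκ : 0 ≤ κ') (hM₂ : 0 ≤ M₂)
    (hγ : ∀ x : ι → ℝ, γ * ∑ e, x e ^ 2 ≤ ∑ e, ∑ e', A e e' * x e * x e')
    (hM : ∀ e, ∑ e', |A e e'| * Real.exp (κ' * dist e e') ≤ M₂)
    (Γ : Finset ι) (π : ↥Γᶜ → σ) (hsep : ∀ y y' : ↥Γᶜ, π y ≠ π y' → w ≤ dist y y')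
    (hδ1 : M₂ * Real.exp (-(κ' * w)) < γ) (F : EuclideanSpace ℝ ↥Γᶜ → ℝ≥0∞) (hF : Measurable F) :
    let B : Matrix ↥Γᶜ ↥Γᶜ ℝ := A.submatrix (fun j : ↥Γᶜ => (j : ι)) (fun j : ↥Γᶜ => (j : ι))
    let δ : ℝ := M₂ * Real.exp (-(κ' * w)) / γ
    let Bbd : Matrix ↥Γᶜ ↥Γᶜ ℝ := Matrix.of fun y y' => if π y = π y' then B y y' else 0
    (∀ x : ↥Γᶜ → ℝ, (1 - δ) * (x ⬝ᵥ Bbd *ᵥ x) ≤ x ⬝ᵥ B *ᵥ x ∧ x ⬝ᵥ B *ᵥ x ≤ (1 + δ) * (x ⬝ᵥ Bbd *ᵥ x)) ∧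
      ENNReal.ofReal ((Real.sqrt (1 - δ) / Real.sqrt (1 + δ)) ^ Fintype.card ↥Γᶜ) *
          ∫⁻ y, F y ∂(multivariateGaussian 0 ((1 + δ) • Bbd)⁻¹) ≤ ∫⁻ y, F y ∂(multivariateGaussian 0 B⁻¹) ∧
      ∫⁻ y, F y ∂(multivariateGaussian 0 B⁻¹) ≤
        ENNReal.ofReal ((Real.sqrt (1 + δ) / Real.sqrt (1 - δ)) ^ Fintype.card ↥Γᶜ) *
          ∫⁻ y, F y ∂(multivariateGaussian 0 ((1 - δ) • Bbd)⁻¹) := by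
  intro B δ Bbd
  have hBsymm : ∀ y y' : ↥Γᶜ, B y y' = B y' y := fun y y' => hA y y'
  have hBγ : ∀ x : ↥Γᶜ → ℝ, γ * ∑ y, x y ^ 2 ≤ ∑ y, ∑ y', B y y' * x y * x y' := coercive_submatrix hγ Γᶜ
  have hBM : ∀ y : ↥Γᶜ, ∑ y' : ↥Γᶜ, |B y y'| * Real.exp (κ' * dist y y') ≤ M₂ := by
    intro y
    have h := Finset.sum_coe_sort Γᶜ (fun e' => |A y e'| * Real.exp (κ' * dist y e'))
    simp only [B, Matrix.submatrix_apply]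
    rw [h]
    exact le_trans (Finset.sum_le_univ_sum_of_nonneg fun e' => mul_nonneg (abs_nonneg _) (Real.exp_pos _).le) (hM y)
  exact decoupling hBsymm π hγ0 hκ hM₂ hBγ hBM hsep hδ1 F hF


/-- **Under the block-diagonal precision the parts are uncorrelated**: the covariance `((c·B_bd))⁻¹` has no entries across the partition
(`B1Eq324BenfattoClassMarkov.inv_apply_eq_zero_of_separated`), so under `N(m, (cB_bd)⁻¹)` the coordinate blocks of different parts are
uncorrelated jointly Gaussian families — independent by the generic Gaussian layer (seat dag-n08-d's
`B1Eq324BenfattoKernelCondField.iIndepFun_condFieldK_of_condCov_eq_zero`), which is what makes the dominating measures of `decoupling` FACTORISE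
over the boxes as in (5.13). [cite: BenfattoEtAl1978, (5.13) p.155 (class substitute; ours)] -/
theorem inv_blockDiag_apply_eq_zero {B : Matrix m m ℝ} (hB : ∀ y y', B y y' = B y' y) (π : m → σ) {γ c : ℝ} (hγ0 : 0 < γ)
    (hc : 0 < c) (hγ : ∀ x : m → ℝ, γ * ∑ y, x y ^ 2 ≤ ∑ y, ∑ y', B y y' * x y * x y') {y y' : m} (hyy' : π y ≠ π y') :
    (c • (Matrix.of fun a b => if π a = π b then B a b else 0 : Matrix m m ℝ))⁻¹ y y' = 0 := by
  have hPD := posDef_smul_of_pos (posDef_blockDiag hB π hγ0 hγ) hc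
  have hdet : IsUnit (c • (Matrix.of fun a b => if π a = π b then B a b else 0 : Matrix m m ℝ)).det :=
    (Matrix.isUnit_iff_isUnit_det _).mp hPD.isUnit
  refine inv_apply_eq_zero_of_separated hdet (fun a => π a = π y) (fun z w hzw => ?_) (fun h => hyy' (h.mp rfl).symm)
  have hne : π z ≠ π w := fun h => hzw (by rw [h])
  simp only [Matrix.smul_apply, Matrix.of_apply, if_neg hne, smul_zero]

end Decoupling


/-! ## §5  Doors from the B9 currency (`QGQInverse.Coercive`, `(e^{κd} − 1)`-weighted rows): entering the class from N06's side -/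

section Doors

variable {ι : Type*} [Fintype ι]

/-- **Coercivity door**: the `dotProduct` form of coercivity (`γ·⟨x,x⟩ ≤ ⟨x, Ax⟩`, the body of the pub-balaban predicate
`QGQInverse.Coercive A γ` used by `B9SectEKernel.gamma0_assembly` for `C*Δ_kC`) is the `Σ`-form used by the class files, and conversely.
[cite: Balaban1985BackgroundPropagators, Sect. E p.428 («a positive definite operator C*Δ_kC with a lower bound γ₀ > 0»; currency bridge ours)] -/
theorem coercive_sum_iff_dot (A : Matrix ι ι ℝ) (γ : ℝ) :
    (∀ x : ι → ℝ, γ * ∑ e, x e ^ 2 ≤ ∑ e, ∑ e', A e e' * x e * x e') ↔ (∀ x : ι → ℝ, γ * (x ⬝ᵥ x) ≤ x ⬝ᵥ (A *ᵥ x)) := by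
  have hform : ∀ x : ι → ℝ, x ⬝ᵥ (A *ᵥ x) = ∑ e, ∑ e', A e e' * x e * x e' := by
    intro x
    simp only [dotProduct, Matrix.mulVec, Finset.mul_sum]
    exact Finset.sum_congr rfl fun e _ => Finset.sum_congr rfl fun e' _ => by ring
  have hsq : ∀ x : ι → ℝ, x ⬝ᵥ x = ∑ e, x e ^ 2 := fun x => by
    simp only [dotProduct]; exact Finset.sum_congr rfl fun e _ => by ring
  constructor
  · intro h x; rw [hform, hsq]; exact h x
  · intro h x; rw [← hform, ← hsq]; exact h x

/-- **Decay door**: an `(e^{κ·dist} − 1)`-weighted absolute row bound (the currency of the pub-balaban inversion lemma `QGQInverse.inverse_decay`,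
B9 (3.132) lineage — PRIOR ART for §2 of `B1Eq324BenfattoClassAppendixC`, which is its symmetric `cosh`-currency twin) implies the `cosh`
row-defect bound of the class with the same constant: `cosh t − 1 ≤ e^t − 1` for `t ≥ 0`.
[cite: Balaban1985BackgroundPropagators, Sect. E p.428 («a uniform exponential decay of C*Δ_kC»; currency bridge ours)] -/
theorem rowDefect_cosh_le_of_exp {A : Matrix ι ι ℝ} {dist : ι → ι → ℝ} {κ ρ : ℝ} (hκ : 0 ≤ κ)
    (hd : ∀ e e', 0 ≤ dist e e') (hrow : ∀ e, ∑ e', |A e e'| * (Real.exp (κ * dist e e') - 1) ≤ ρ) (e : ι) :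
    ∑ e', |A e e'| * (Real.cosh (κ * dist e e') - 1) ≤ ρ := by
  refine le_trans (Finset.sum_le_sum fun e' _ => mul_le_mul_of_nonneg_left ?_ (abs_nonneg _)) (hrow e)
  have ht : 0 ≤ κ * dist e e' := mul_nonneg hκ (hd e e')
  have h1 : Real.exp (-(κ * dist e e')) ≤ Real.exp (κ * dist e e') := Real.exp_le_exp.2 (by linarith)
  rw [Real.cosh_eq]
  linarith

end Doors

end Literature.MathematicalPhysics.QuantumFieldTheory.Balaban1983to89.B1Eq324BenfattoClassDecoupling

end
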